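import Literature.NumberTheory.EllipticCurves.HeightDensityFullBSDOffSSieve
import Literature.NumberTheory.EllipticCurves.Rank1Residual.X11
import HarnessLib

/-!
# The full BSD formula off `S_m′(E)` for a proportion `≥ c` of elliptic curves over `ℚ` by height
# (row (ii-2) of `PERCENT-FULL.md`, typed)

Companion of `HeightDensityFullBSDOffS.lean` / `HeightDensityFullBSDOffSSieve.lean` (row (ii-1): the
full BSD formula at every good ordinary prime `p ≥ 5` outside the finite set `Z*(E)`, for at least the
rank-part proportion of curves). Row (ii-2) of the `pub-bsdpct` cell's `PERCENT-FULL.md` adds the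
MULTIPLICATIVE primes: with

* `Z*(E) := {p : ∃ ℓ ∥ N_E, ℓ ≡ ±1 (mod p), p ∣ v_ℓ(Δ_min)}` (`InZstar`; hypothesis (d) of
  Skinner–Zhang Thm. 1.1 / hypothesis (2) of W. Zhang Thm. 1.4 fails at `p`), and
* `M*(E) :=` the multiplicative primes `p ≥ 5` of `E` at which hypothesis (b) of Skinner–Zhang
  Thm. 1.1 fails (`p ∣ v_p(Δ_min)`, or `E` split multiplicative at `p` with `log_p q_E ∉ pℤ_p^×`;
  hypothesis (b) is the predicate `SZ14HypB`),

`S_m′(E) := {2, 3} ∪ {additive p} ∪ {good supersingular p} ∪ M*(E) ∪ Z*(E)`, and the row asserts: at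
least the rank-part proportion `c` of curves `E_{A,B}` (by naive height) satisfy the rank part of BSD
AND Miller's `BSD(E,p)` at every prime `p ∉ S_m′(E)`, i.e. at every `p ≥ 5` that is good ordinary
outside `Z*(E)` (`FullBSDOffSgoPrime`) or multiplicative outside `M*(E) ∪ Z*(E)`
(`FullBSDOffSmPrime`).

Inputs at a multiplicative prime `p ≥ 5` (PERCENT-FULL §(ii).3, H-MULT):

* rank `0`: C. Skinner, *Multiplicative reduction and the cyclotomic main conjecture for `GL₂`*,
  Pacific J. Math. 283 (2016) 171–200, Thm. C (PUBLISHED; tree fact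
  `Skinner2016_padicValRat_bsd_rank_zero`): "(i) `E[p]` irreducible; (ii) there exists a prime
  `q ≠ p` at which `E` has multiplicative reduction and `E[p]` is ramified. If `L(E,1) ≠ 0` then
  `|L(E,1)/Ω_E|_p^{-1} = |#Ш(E)∏_ℓ c_ℓ(E)|_p^{-1}`" — (i) from surjectivity (F1), (ii) from the two
  exact primes (F3); NO (b)/(d)-type condition in rank `0`;
* rank `1`: C. Skinner, W. Zhang, *Indivisibility of Heegner points in the multiplicative case*,
  arXiv:1407.1099 (2014), Thm. 1.2 under hypotheses (a)–(e) of Thm. 1.1 — an UNREFEREED preprint,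
  carried by the tree ONLY as the explicitly labelled OPEN hypothesis
  `SkinnerZhang2014.thm1_2_padicVal_bsd_rankOne_OPEN` (`[claim: SkinnerZhang2014, status:
  under-review]`), which therefore appears here as the binder `hSZ` and nowhere as a theorem:
  (a) = multiplicative at `p`; (b) = `p ∉ M*(E)`; (c) irreducible, from (F1); (d) = `p ∉ Z*(E)`;
  (e) two `ℓ ∥ N` with `p ∤ v_ℓ(Δ_min)`, from (F3).

Generic inputs, all KERNEL THEOREMS or named PUBLISHED facts of the tree: (F1) Duke 1997 Thm. 1
(`Duke1997_exceptionalPrimes_densityZero` → `heightDensityGE_forall_surj_of_duke`); (F3) the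
two-exact-primes sieve (`heightDensityGE_twoOrdOnePrimes_one`, from `TwoMultiplicativePrimesDensity`);
(T) `v_ℓ(Δ_min) = ord_ℓ(4A³ + 27B²)` at `ℓ ≥ 5` (`padicValInt_minimalDiscriminantInt_smul_shortWeierstrass`);
the print-shape bridges `bsdp_of_padicVal_printShape_rankZero` (rank `0`) and
`Rank1Residual.bsdp_of_skinnerZhang_OPEN` (rank `1`); modularity; Gross–Zagier–Kolyvagin.

PROVED here (no `sorry`, standard axioms; no named fact — the only definitions are the predicates
`SZ14HypB` and `FullBSDOffSmPrime`): the per-pair glue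
`bsdp_of_Skinner2016_of_skinnerZhang_OPEN` and the transfer theorem
`HeightDensityGE.rankLeOne_and_fullBSDOffSmPrime_of_sieve` with its instance at
`c_rank = 3059480216411717/4576171406400000`. Every statement using `hSZ` is CONDITIONAL on the
Skinner–Zhang preprint (evidence class PRE in the cell's bookkeeping), exactly as row (ii-2) is
printed ("modulo [SZ14] PRE at general multiplicative `p`").

## References

* C. Skinner, Pacific J. Math. 283 (2016) 171–200, Thm. C. [cite: Skinner2016PacificMC, Thm. C]
* C. Skinner, W. Zhang, arXiv:1407.1099v1 (2014), Thms 1.1–1.2.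
  [claim: SkinnerZhang2014, status: under-review]
* M. Bhargava, C. Skinner, W. Zhang, arXiv:1407.1826 (2014), Lemma 20 (proof).
  [cite: BhargavaSkinnerZhang2014, Lemma 20 (proof, p. 10)]
* W. Duke, C. R. Acad. Sci. Paris 325 (1997) 813–818, Thm. 1. [cite: Duke1997, Thm. 1 (p. 815)]
* R. L. Miller, LMS J. Comput. Math. 14 (2011), Def. 1.1 (`BSDp`). [cite: Miller2011LMS, Def. 1.1]
-/

noncomputable section

open scoped Classical
open WeierstrassCurve Filter Topology Literature.NumberTheory.EllipticCurves

namespace Literature.NumberTheory.EllipticCurves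

/-! ### Hypothesis (b) of Skinner–Zhang and the property "full BSD off `S_m′(E)`" -/

/-- **Hypothesis (b) of Skinner–Zhang, Thm. 1.1, at the prime `p`** (arXiv:1407.1099v1 p. 1: "`p ∤
ord_p(Δ)`, and if `E` has split multiplicative reduction at `p` then `log_p q_E ∈ pℤ_p^×`, where
`q_E ∈ ℚ_p^×` is the Tate period of `E/ℚ_p`"), transcribed exactly as the two fields
`not_dvd_ord_disc` / `log_tatePeriod` of the tree's `SkinnerZhang2014.Hypotheses`. The multiplicative
primes `p ≥ 5` failing it form the finite set `M*(E)` of `PERCENT-FULL.md` row (ii-2). A predicate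
(no claim). [cite: SkinnerZhang2014, Thm. 1.1, hypothesis (b) (arXiv:1407.1099v1 p. 1)] -/
def SZ14HypB (W : WeierstrassCurve ℚ) [W.IsElliptic] [W.IsGloballyMinimal] (p : ℕ) [Fact p.Prime] :
    Prop :=
  ¬ p ∣ padicValInt p W.minimalDiscriminantInt ∧
    (W.HasSplitMultiplicativeReductionAtPrime p →
      ∀ D : TateParameterData W p, (padicLog p D.q).valuation = 1)

/-- **The full BSD formula at the multiplicative primes off `M*(E) ∪ Z*(E)`** for the curve
`E_{A,B}`: for every globally minimal model `W = C • E_{A,B}` and every prime `p ≥ 5` of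
multiplicative reduction at which Skinner–Zhang's hypothesis (b) holds (`p ∉ M*(E)`) and `p ∉ Z*(E)`,
Miller's `BSD(E,p)` holds. Together with `FullBSDOffSgoPrime` this is "`BSD(E,p)` for every
`p ∉ S_m′(E)`", row (ii-2) of `PERCENT-FULL.md`. [cite: Miller2011LMS, Def. 1.1 (arXiv:1010.2431 p. 3)] -/
def FullBSDOffSmPrime (AB : ℤ × ℤ) : Prop :=
  ∀ (W : WeierstrassCurve ℚ) [W.IsElliptic] [W.IsGloballyMinimal] (C : VariableChange ℚ),
    C • shortWeierstrass AB = W → ∀ (p : ℕ) [Fact p.Prime], 5 ≤ p →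
      W.HasMultiplicativeReductionAtPrime p → SZ14HypB W p → ¬ InZstar W p → BSDp W p

/-- `ℓ ≡ ±1 (mod p)` in Skinner–Zhang's spelling (`(ℓ : ZMod p) = ±1`) implies W. Zhang's spelling
(`p ∣ ℓ - 1 ∨ p ∣ ℓ + 1`) used by `InZstar`. [folklore] -/
theorem dvd_sub_one_or_dvd_add_one_of_cast_eq {p ℓ : ℕ} [NeZero p] (hℓ : 1 ≤ ℓ)
    (h : (ℓ : ZMod p) = 1 ∨ (ℓ : ZMod p) = -1) : p ∣ ℓ - 1 ∨ p ∣ ℓ + 1 := by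
  rcases h with h | h
  · left
    have h' : ((1 : ℕ) : ZMod p) = (ℓ : ZMod p) := by rw [Nat.cast_one, h]
    exact (Nat.modEq_iff_dvd' hℓ).mp ((ZMod.natCast_eq_natCast_iff _ _ _).mp h')
  · right
    have h' : ((ℓ + 1 : ℕ) : ZMod p) = 0 := by rw [Nat.cast_add, Nat.cast_one, h, neg_add_cancel]
    exact (ZMod.natCast_eq_zero_iff _ _).mp h'

/-! ### The per-pair glue at a multiplicative prime -/

/-- **`BSD(E,p)` at a multiplicative prime `p ≥ 5` in analytic rank `≤ 1`** — rank `0` from Skinner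
2016 Thm. C (tree fact `Skinner2016_padicValRat_bsd_rank_zero`: irreducible `E[p]` and a second
multiplicative prime `q ≠ p` with `p ∤ v_q(Δ_min)`; `L(E,1) ≠ 0` by modularity), rank `1` from the
OPEN binder Skinner–Zhang 2014 Thm. 1.2 (`SkinnerZhang2014.thm1_2_padicVal_bsd_rankOne_OPEN`, via
`Rank1Residual.bsdp_of_skinnerZhang_OPEN`) whose hypotheses (a)–(e) are: multiplicative `p`,
(b) = `SZ14HypB`, irreducibility (from surjectivity), (d) = `p ∉ Z*(E)`, (e) = two distinct
multiplicative primes with `p ∤ v_ℓ(Δ_min)`. CONDITIONAL on the unrefereed Skinner–Zhang preprint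
through `hSZ` in rank `1`; unconditional-in-print in rank `0`.
[cite: Skinner2016PacificMC, Thm. C] [claim: SkinnerZhang2014, status: under-review] -/
theorem bsdp_of_Skinner2016_of_skinnerZhang_OPEN (hSk : Skinner2016_padicValRat_bsd_rank_zero)
    (hSZ : SkinnerZhang2014.thm1_2_padicVal_bsd_rankOne_OPEN) (hmod : hasEntireLFunction_rat)
    (hGZK : rank_eq_analyticRank_of_analyticRank_le_one)
    (W : WeierstrassCurve ℚ) [W.IsElliptic] [W.IsGloballyMinimal] (p : ℕ) [Fact p.Prime]
    (hp : 5 ≤ p) (hmult : W.HasMultiplicativeReductionAtPrime p)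
    (hsurj : W.HasSurjectiveModNGaloisRep p) (hb : SZ14HypB W p) (hZs : ¬ InZstar W p)
    (htwo : ∃ ℓ₁ ℓ₂ : ℕ, ∃ _ : Fact ℓ₁.Prime, ∃ _ : Fact ℓ₂.Prime, ℓ₁ ≠ ℓ₂ ∧
      W.HasMultiplicativeReductionAtPrime ℓ₁ ∧ ¬ p ∣ padicValInt ℓ₁ W.minimalDiscriminantInt ∧
      W.HasMultiplicativeReductionAtPrime ℓ₂ ∧ ¬ p ∣ padicValInt ℓ₂ W.minimalDiscriminantInt)
    (hr : W.analyticRank ≤ 1) : BSDp W p := by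
  haveI : NeZero p := ⟨(Fact.out : p.Prime).ne_zero⟩
  have hirr : W.HasIrreducibleModPGaloisRep p :=
    hasIrreducibleModPGaloisRep_of_hasSurjectiveModNGaloisRep W p hsurj
  obtain ⟨ℓ₁, ℓ₂, i₁, i₂, hne, hm₁, hv₁, hm₂, hv₂⟩ := htwo
  rcases Nat.lt_or_ge W.analyticRank 1 with h0 | h1
  · -- analytic rank 0: Skinner 2016 Thm. C
    have hr0 : W.analyticRank = 0 := by omega
    have hfin : Finite W.sha := (hGZK W hr).2
    have hL : W.entireLFunction 1 ≠ 0 := by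
      rw [← W.leadingLCoeff_eq_of_analyticRank_eq_zero hr0]
      exact W.leadingLCoeff_ne_zero_holds (hmod W)
    have hram : ∃ q : ℕ, ∃ _ : Fact q.Prime, q ≠ p ∧ W.HasMultiplicativeReductionAtPrime q ∧
        ¬ p ∣ padicValInt q W.minimalDiscriminantInt := by
      by_cases h : ℓ₁ = p
      · exact ⟨ℓ₂, i₂, fun h' ↦ hne (h.trans h'.symm), hm₂, hv₂⟩
      · exact ⟨ℓ₁, i₁, h, hm₁, hv₁⟩
    exact Rank1Residual.bsdp_of_padicVal_printShape_rankZero W p hGZK hr0 hirr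
      (hSk W p (by omega) (Or.inr hmult) hirr hram hL hfin)
  · -- analytic rank 1: Skinner–Zhang 2014 Thm. 1.2 (OPEN binder)
    have hr1 : W.analyticRank = 1 := le_antisymm hr h1
    have hH : SkinnerZhang2014.Hypotheses W p :=
      { mult := hmult
        not_dvd_ord_disc := hb.1
        log_tatePeriod := hb.2
        irr := hirr
        ram_of_congr := fun ℓ iℓ hm hc hv ↦
          hZs ⟨ℓ, iℓ, hm, dvd_sub_one_or_dvd_add_one_of_cast_eq iℓ.out.one_lt.le hc, hv⟩
        two_ramified := ⟨ℓ₁, ℓ₂, i₁, i₂, hne, hm₁, hm₂, hv₁, hv₂⟩ }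
    exact Rank1Residual.bsdp_of_skinnerZhang_OPEN W p hSZ hGZK hp hH hr1

/-! ### The transfer theorem: rank part at proportion `c` ⇒ full BSD off `S_m′` at proportion `c` -/

/-- **Full BSD off `S_m′(E)` for at least the rank-part proportion of curves (row (ii-2) of
`PERCENT-FULL.md`, typed; (F1) and (F3) discharged).** If a proportion `≥ c` of the curves
`E_{A,B}/ℚ`, ordered by naive height, satisfy the rank part of BSD with analytic rank `≤ 1`, then —
given the named facts Duke 1997 Thm. 1, Skinner–Urban 2014 Thm. 2 (a) (bsd.S30), W. Zhang 2014
Thm. 1.6/1.4, Skinner 2016 Thm. C, modularity, Gross–Zagier–Kolyvagin, AND the OPEN binder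
Skinner–Zhang 2014 Thm. 1.2 (unrefereed; used only at multiplicative primes in rank `1`) — a
proportion `≥ c` satisfy the rank part AND `BSD(E,p)` at every prime `p ≥ 5` that is either good
ordinary outside `Z*(E)` or multiplicative outside `M*(E) ∪ Z*(E)`. Proof: row (ii-1)
(`HeightDensityGE.rankLeOne_and_fullBSDOffSgoPrime_of_sieve`) intersected with the density-one sets
of (F1) (`heightDensityGE_forall_surj_of_duke`) and (F3) (`heightDensityGE_twoOrdOnePrimes_one`), then
pointwise `bsdp_of_Skinner2016_of_skinnerZhang_OPEN` on the minimal model, the two exact primes of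
(F3) being multiplicative with `v_ℓ(Δ_min) = 1` by (T) and the Lemma-17 criterion.
[cite: Skinner2016PacificMC, Thm. C] [claim: SkinnerZhang2014, status: under-review]
[cite: BhargavaSkinnerZhang2014, Lemma 20 (proof, p. 10)] [cite: Duke1997, Thm. 1 (p. 815)] -/
theorem HeightDensityGE.rankLeOne_and_fullBSDOffSmPrime_of_sieve
    (hD : Duke1997_exceptionalPrimes_densityZero)
    (hS30 : padicValRat_bsd_rank_zero) (hZ : WZhang2014_padicValRat_bsd_rank_one_ordinary)
    (hSk : Skinner2016_padicValRat_bsd_rank_zero)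
    (hSZ : SkinnerZhang2014.thm1_2_padicVal_bsd_rankOne_OPEN)
    (hmod : hasEntireLFunction_rat) (hGZK : rank_eq_analyticRank_of_analyticRank_le_one)
    {c : ℝ} (hA : HeightDensityGE SatisfiesBSDRankLeOne c) :
    HeightDensityGE
      (fun AB ↦ SatisfiesBSDRankLeOne AB ∧ FullBSDOffSgoPrime AB ∧ FullBSDOffSmPrime AB) c := by
  have h3 := ((HeightDensityGE.rankLeOne_and_fullBSDOffSgoPrime_of_sieve hD hS30 hZ hmod hGZK
    hA).and_of_one (heightDensityGE_forall_surj_of_duke hD)).and_of_one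
      heightDensityGE_twoOrdOnePrimes_one
  refine BhargavaSkinnerZhang2014.HeightDensityGE.mono ?_ h3
  rintro AB ⟨⟨⟨hR, hgo⟩, hS⟩, hM⟩
  refine ⟨hR, hgo, ?_⟩
  intro W _ _ C hW p _ hp hmult hb hZs
  have hfam : IsInHeightFamily AB := hR.1
  haveI := isElliptic_shortWeierstrass hfam
  -- analytic rank of the minimal model `W = C • E_{A,B}`
  have hr : W.analyticRank ≤ 1 := by
    have e : (C • shortWeierstrass AB).analyticRank = (shortWeierstrass AB).analyticRank :=
      analyticRank_variableChange_holds (shortWeierstrass AB) C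
    rw [← hW, e]
    exact hR.2.2.1
  -- two distinct multiplicative primes with `v_ℓ(Δ_min) = 1`, from (F3) and (T)
  obtain ⟨ℓ₁, ℓ₂, hℓ₁, hℓ₂, h5₁, h5₂, hne, hv₁, hv₂⟩ := hM
  haveI i₁ : Fact ℓ₁.Prime := ⟨hℓ₁⟩
  haveI i₂ : Fact ℓ₂.Prime := ⟨hℓ₂⟩
  have hpP : p.Prime := Fact.out
  have hm₁ : W.HasMultiplicativeReductionAtPrime ℓ₁ :=
    hW ▸ hasMultiplicativeReductionAtPrime_smul_shortWeierstrass_of_padicValInt_eq_one hfam C h5₁ hv₁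
  have hm₂ : W.HasMultiplicativeReductionAtPrime ℓ₂ :=
    hW ▸ hasMultiplicativeReductionAtPrime_smul_shortWeierstrass_of_padicValInt_eq_one hfam C h5₂ hv₂
  have hw₁ : ¬ p ∣ padicValInt ℓ₁ W.minimalDiscriminantInt := by
    rw [padicValInt_minimalDiscriminantInt_smul_shortWeierstrass hfam W C hW h5₁, hv₁]
    exact hpP.not_dvd_one
  have hw₂ : ¬ p ∣ padicValInt ℓ₂ W.minimalDiscriminantInt := by
    rw [padicValInt_minimalDiscriminantInt_smul_shortWeierstrass hfam W C hW h5₂, hv₂]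
    exact hpP.not_dvd_one
  exact bsdp_of_Skinner2016_of_skinnerZhang_OPEN hSk hSZ hmod hGZK W p hp hmult (hS W C hW p) hb hZs
    ⟨ℓ₁, ℓ₂, i₁, i₂, hne, hm₁, hw₁, hm₂, hw₂⟩ hr

/-- **Row (ii-2) of `PERCENT-FULL.md` at `c_rank = 3059480216411717 / 4576171406400000 = 0.66856766…`**
(Theorem A′'s rank-part conclusion as the hypothesis `hA`; Skinner–Zhang 2014 Thm. 1.2 as the OPEN
binder `hSZ`; everything else a published theorem vendored as a named fact, or a kernel theorem).
[cite: Skinner2016PacificMC, Thm. C] [claim: SkinnerZhang2014, status: under-review] -/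
theorem heightDensityGE_rankLeOne_and_fullBSDOffSmPrime_cRank_of_sieve
    (hA : HeightDensityGE SatisfiesBSDRankLeOne (3059480216411717 / 4576171406400000))
    (hD : Duke1997_exceptionalPrimes_densityZero)
    (hS30 : padicValRat_bsd_rank_zero) (hZ : WZhang2014_padicValRat_bsd_rank_one_ordinary)
    (hSk : Skinner2016_padicValRat_bsd_rank_zero)
    (hSZ : SkinnerZhang2014.thm1_2_padicVal_bsd_rankOne_OPEN)
    (hmod : hasEntireLFunction_rat) (hGZK : rank_eq_analyticRank_of_analyticRank_le_one) :
    HeightDensityGE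
      (fun AB ↦ SatisfiesBSDRankLeOne AB ∧ FullBSDOffSgoPrime AB ∧ FullBSDOffSmPrime AB)
      (3059480216411717 / 4576171406400000) :=
  HeightDensityGE.rankLeOne_and_fullBSDOffSmPrime_of_sieve hD hS30 hZ hSk hSZ hmod hGZK hA

end Literature.NumberTheory.EllipticCurves

end
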